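import Summits.BirchSwinnertonDyer.Rank1Residual.GaloisImage.CyclotomicGroupRingEvaluation
import Literature.NumberTheory.Sieve.MontgomeryVaughan1975GaussSums
import Literature.NumberTheory.EllipticCurves.CuspFormTwist
import Mathlib.NumberTheory.Cyclotomic.PrimitiveRoots
import Mathlib.LinearAlgebra.FiniteDimensional.Lemmas
import Mathlib.Algebra.MonoidAlgebra.Module
import Mathlib.FieldTheory.IsAlgClosed.Basic
import HarnessLib

/-!
# The evaluation `ℚ[(ℤ/n)ˣ] → ℚ(ζ_n)` is a bijection for square-free `n` (normal basis generated by
# `ζ_n`) — T-PKEV file E-D (cell `b2b-bsdres`, team n1011, ROUTE-1 PORT (P-KIM); located design point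
# Q-X of p02's PK-4a names line; seat p02 GEN 12)

HONEST FRAMING (cell `b2b-bsdres`, run/shared/lean/b2b/bsd-rank1-residual/, verbatim in every
file): the goal of the cell is to DELETE the COMBINATION-SHAPED residual classes of the
Birch–Swinnerton-Dyer formula for ALL analytic-rank `≤ 1` elliptic curves over `ℚ` — "full BSD
formula for every rank `≤ 1` curve in class `C`" assembled STRICTLY from published theorems — so
that the rank-`≤ 1` remainder becomes exactly the CONSTRUCTION-SHAPED classes, which are TYPED
(missing-input `Prop`s), NOT attempted. This is not "finishing BSD". Team n1011 (N10/N11; ROUTE 1,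
the PORT anatomy (P-KIM) of class X4 ∧ `p = 3`): research route on CONSTRUCTION-SHAPED classes;
prove what is provable now; no claim beyond stated classes; census output = EVIDENCE, never a
Literature fact; RESIDUAL-MAP marks UNCHANGED; nothing is booked by this file. TOOL THEOREMS ONLY:
no definition, no named fact, no instance, no `sorry`.

## What

PK-4b-C (p15) and PK-6 at a general level (p13) compare Kato's rational value `x_{0,r} ∈ ℚ(ζ_n)`
(`ZetaBody` C4) with group-ring elements of `ℚ[(ℤ/n)ˣ]` (the Mazur–Tate side, PK-3 / F-B / F-C).
Files E-A/E-B/E-C let the group ring ACT on `ℚ(ζ_n)`; this file shows that for SQUARE-FREE `n`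
(every Kolyvagin level is) the evaluation at `ζ_n`, `X ↦ Σ_g X_g · σ_g ζ_n = Σ_g X_g ζ_n^g`, is a
ℚ-linear BIJECTION `ℚ[(ℤ/n)ˣ] ≅ ℚ(ζ_n)` — i.e. the conjugates of `ζ_n` form a normal basis — so
that `x_{0,r}` HAS a unique group-ring avatar `X` (`exists_unique_eq_sum_coeff_smul_sigma_zeta`),
whose character components are then read off Kato's character sums (p02 PK-4a) through
`lift χ̄ X · charSum n ι χ ζ_n = charSum n ι χ x` (E-A `charSum_sum_coeff_smul_sigma`):

* `gaussSum_ne_zero_of_squarefree` — EVERY Dirichlet character mod a square-free `n` has a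
  non-zero Gauss sum: `τ_n(χ) = μ(n/n₀) χ₀(n/n₀) τ(χ₀)` for `χ` induced from the primitive `χ₀` mod
  `n₀` (the tree's `gaussSum_changeLevel`, Montgomery–Vaughan 1975 Lemma 5.2), and `μ(n/n₀) ≠ 0`,
  `gcd(n/n₀, n₀) = 1`, `τ(χ₀) ≠ 0`; hence `charSum_zeta_ne_zero_of_squarefree`
  (`charSum n ι χ ζ_n = χ(u)⁻¹ τ_n(χ)`, F-A);
* `eq_zero_of_forall_lift_eq_zero` — group-ring Fourier inversion: an element of `ℚ[(ℤ/n)ˣ]` all of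
  whose character components vanish is `0` (orthogonality, Mathlib
  `DirichletCharacter.sum_char_inv_mul_char_eq`);
* ★ `eq_of_sum_coeff_smul_sigma_zeta_eq` (injectivity) and
  ★ `exists_unique_eq_sum_coeff_smul_sigma_zeta` (bijectivity, by `finrank ℚ ℚ(ζ_n) = φ(n) = #(ℤ/n)ˣ`);
* `lift_eq_charSum_div_charSum_zeta` — the components of the avatar:
  `χ̄(X) = charSum n ι χ x / charSum n ι χ ζ_n`.

HONEST LIMITS: pure cyclotomic algebra; square-free `n` only (for `n = 4`, `ζ_4 + ζ_4^3 = 0`: the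
statement is false in general); nothing about `ZetaBody`, modular symbols or Kolyvagin systems;
closes nothing; books nothing; 0 defs / 0 facts.

References: H. L. Montgomery, R. C. Vaughan, Acta Arith. 27 (1975) §5 Lemma 5.2 (imprimitive Gauss
sums) [MontgomeryVaughanActa1975]; normal integral bases of `ℚ(ζ_n)`, `n` square-free
(Hilbert–Speiser) [folklore]; K. Kato, Astérisque 295 (2004) (5.7.1) p. 157 [Kato2004Asterisque].
-/

noncomputable section

open scoped BigOperators
open Finset

namespace Summit.BirchSwinnertonDyer.Rank1Residual.GaloisImage

namespace GroupRingEval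

open Literature.NumberTheory.EllipticCurves.Kato2004.EulerSystemValues

variable (n : ℕ) [NeZero n]

/-! ### §1 Gauss sums mod a square-free modulus never vanish -/

omit [NeZero n] in
/-- For square-free `n` and `n₀ ∣ n`: `μ(n/n₀) ≠ 0` and `gcd(n/n₀, n₀) = 1`. [folklore] -/
theorem moebius_div_ne_zero_and_coprime_of_squarefree (hn : Squarefree n) {n₀ : ℕ} (h : n₀ ∣ n) :
    (ArithmeticFunction.moebius (n / n₀) : ℤ) ≠ 0 ∧ (n / n₀).Coprime n₀ := by
  obtain ⟨e, rfl⟩ := h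
  have hn0 : n₀ ≠ 0 := by rintro rfl; simp at hn
  have hne : n₀ * e / n₀ = e := Nat.mul_div_cancel_left e (Nat.pos_of_ne_zero hn0)
  rw [hne]
  refine ⟨ArithmeticFunction.moebius_ne_zero_iff_squarefree.mpr
    (hn.squarefree_of_dvd (Dvd.intro_left n₀ rfl)), ?_⟩
  rw [mul_comm] at hn
  exact Nat.coprime_of_squarefree_mul hn

/-- **Every Dirichlet character mod a square-free `n` has a non-zero Gauss sum**:
`τ_n(χ) = μ(n/n₀)·χ₀(n/n₀)·τ(χ₀) ≠ 0`, `χ₀` the primitive character inducing `χ`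
(Montgomery–Vaughan 1975, Lemma 5.2, the tree's `gaussSum_changeLevel`).
[cite: MontgomeryVaughanActa1975, §5 Lemma 5.2] -/
theorem gaussSum_ne_zero_of_squarefree (hn : Squarefree n) (χ : DirichletCharacter ℂ n) :
    gaussSum χ (ZMod.stdAddChar (N := n)) ≠ 0 := by
  haveI : NeZero χ.conductor := ⟨χ.conductor_ne_zero⟩
  obtain ⟨hμ, hcop⟩ := moebius_div_ne_zero_and_coprime_of_squarefree n hn χ.conductor_dvd_level
  have h := Literature.NumberTheory.Sieve.MontgomeryVaughan1975.gaussSum_changeLevel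
    χ.conductor_dvd_level χ.primitiveCharacter
  rw [DirichletCharacter.changeLevel_primitiveCharacter] at h
  rw [h]
  refine mul_ne_zero (mul_ne_zero (by exact_mod_cast hμ) ?_)
    (Literature.NumberTheory.EllipticCurves.ModularForms.gaussSum_stdAddChar_ne_zero_of_isPrimitive
      χ.primitiveCharacter_isPrimitive)
  -- `χ₀(n/n₀) ≠ 0` since `n/n₀` is a unit mod `n₀`
  rw [← ZMod.coe_unitOfCoprime _ hcop, ← MulChar.coe_toUnitHom]
  exact Units.ne_zero _

set_option backward.isDefEq.respectTransparency false in
/-- **`charSum n ι χ ζ_n ≠ 0` for every `χ` mod a square-free `n`** (`= χ(u)⁻¹ τ_n(χ)`, F-A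
`charSum_zeta_eq_inv_mul_gaussSum`). [cite: MontgomeryVaughanActa1975, §5 Lemma 5.2] -/
theorem charSum_zeta_ne_zero_of_squarefree (hn : Squarefree n) (ι : CyclotomicField n ℚ →+* ℂ)
    (χ : DirichletCharacter ℂ n) :
    charSum n ι χ (IsCyclotomicExtension.zeta n ℚ (CyclotomicField n ℚ)) ≠ 0 := by
  obtain ⟨u, hu⟩ := CharSum.exists_units_apply_zeta_eq_exp n ι
  rw [CharSum.charSum_zeta_eq_inv_mul_gaussSum n ι χ u hu]
  refine mul_ne_zero ?_ (gaussSum_ne_zero_of_squarefree n hn χ)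
  rw [CharSum.inv_apply_coe_units, ZMod.inv_coe_unit, ← MulChar.coe_toUnitHom]
  exact Units.ne_zero _

/-! ### §2 Group-ring Fourier inversion and injectivity of the evaluation -/

/-- **Group-ring Fourier inversion on `(ℤ/n)ˣ`**: `φ(n) · X_g = Σ_χ χ⁻¹(g) · χ(X)` for
`X ∈ ℚ[(ℤ/n)ˣ]`, `χ(X) = Σ_h X_h χ(h)` its `χ`-component (`MonoidAlgebra.lift`). [folklore] -/
theorem totient_mul_coeff_eq_sum_lift (X : MonoidAlgebra ℚ (ZMod n)ˣ) (g : (ZMod n)ˣ) :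
    (n.totient : ℂ) * (X.coeff g : ℂ) =
      ∑ χ : DirichletCharacter ℂ n, χ⁻¹ (g : ZMod n) *
        MonoidAlgebra.lift ℚ ℂ (ZMod n)ˣ ((Units.coeHom ℂ).comp χ.toUnitHom) X := by
  haveI := CharSum.hasEnoughRootsOfUnity_exponent_units n
  have hlift : ∀ χ : DirichletCharacter ℂ n,
      MonoidAlgebra.lift ℚ ℂ (ZMod n)ˣ ((Units.coeHom ℂ).comp χ.toUnitHom) X =
        ∑ h : (ZMod n)ˣ, (X.coeff h : ℂ) * χ (h : ZMod n) := by
    intro χ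
    rw [MonoidAlgebra.lift_apply, Finsupp.sum_fintype _ _ (fun h => by rw [zero_smul])]
    refine Finset.sum_congr rfl fun h _ => ?_
    rw [Algebra.smul_def, eq_ratCast, MonoidHom.comp_apply, Units.coeHom_apply, MulChar.coe_toUnitHom]
  simp_rw [hlift, Finset.mul_sum]
  rw [Finset.sum_comm]
  have horth : ∀ h : (ZMod n)ˣ, ∑ χ : DirichletCharacter ℂ n, χ⁻¹ (g : ZMod n) * χ (h : ZMod n) =
      if (g : ZMod n) = h then (n.totient : ℂ) else 0 := by
    intro h
    have := DirichletCharacter.sum_char_inv_mul_char_eq ℂ (Units.isUnit g) (h : ZMod n)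
    simp_rw [CharSum.inv_apply_coe_units]
    exact this
  have hterm : ∀ h : (ZMod n)ˣ, ∑ χ : DirichletCharacter ℂ n,
      χ⁻¹ (g : ZMod n) * ((X.coeff h : ℂ) * χ (h : ZMod n)) =
        (X.coeff h : ℂ) * (if (g : ZMod n) = h then (n.totient : ℂ) else 0) := by
    intro h
    rw [← horth h, Finset.mul_sum]
    exact Finset.sum_congr rfl fun χ _ => by ring
  simp_rw [hterm]
  rw [Finset.sum_eq_single g (fun h _ hne => by
      rw [if_neg (fun e => hne (Units.ext e).symm), mul_zero]) (fun hg => absurd (Finset.mem_univ g) hg),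
    if_pos rfl, mul_comm]

/-- **An element of `ℚ[(ℤ/n)ˣ]` with all character components zero is zero.** [folklore] -/
theorem eq_zero_of_forall_lift_eq_zero (X : MonoidAlgebra ℚ (ZMod n)ˣ)
    (h : ∀ χ : DirichletCharacter ℂ n,
      MonoidAlgebra.lift ℚ ℂ (ZMod n)ˣ ((Units.coeHom ℂ).comp χ.toUnitHom) X = 0) : X = 0 := by
  refine MonoidAlgebra.coeff_injective (Finsupp.ext fun g => ?_)
  have key := totient_mul_coeff_eq_sum_lift n X g
  simp_rw [h, mul_zero, Finset.sum_const_zero] at key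
  have hφ : (n.totient : ℂ) ≠ 0 := by exact_mod_cast (Nat.totient_pos.mpr (NeZero.pos n)).ne'
  have hg : (X.coeff g : ℂ) = 0 := (mul_eq_zero.mp key).resolve_left hφ
  rw [MonoidAlgebra.coeff_zero, Finsupp.zero_apply]
  exact_mod_cast hg

set_option backward.isDefEq.respectTransparency false in
/-- **★ Injectivity of the evaluation at `ζ_n`, `n` square-free**: if `Σ_g X_g · σ_g ζ_n = 0` then
`X = 0` (apply `charSum χ⁻¹`: `χ(X) · charSum χ⁻¹ ζ_n = 0` with the second factor non-zero).
[cite: MontgomeryVaughanActa1975, §5 Lemma 5.2] -/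
theorem eq_zero_of_sum_coeff_smul_sigma_zeta_eq_zero (hn : Squarefree n)
    (X : MonoidAlgebra ℚ (ZMod n)ˣ)
    (h : ∑ g : (ZMod n)ˣ, X.coeff g •
      sigma n g (IsCyclotomicExtension.zeta n ℚ (CyclotomicField n ℚ)) = 0) : X = 0 := by
  let ι : CyclotomicField n ℚ →+* ℂ := (IsAlgClosed.lift : CyclotomicField n ℚ →ₐ[ℚ] ℂ).toRingHom
  refine eq_zero_of_forall_lift_eq_zero n X fun χ => ?_
  have key := charSum_sum_coeff_smul_sigma n ι χ⁻¹ X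
    (IsCyclotomicExtension.zeta n ℚ (CyclotomicField n ℚ))
  rw [h, CharSum.charSum_zero, inv_inv] at key
  exact (mul_eq_zero.mp key.symm).resolve_right (charSum_zeta_ne_zero_of_squarefree n hn ι χ⁻¹)

set_option backward.isDefEq.respectTransparency false in
/-- **★ Injectivity, two-sided form**: equal values at `ζ_n` force equal group-ring elements
(`n` square-free). [cite: MontgomeryVaughanActa1975, §5 Lemma 5.2] -/
theorem eq_of_sum_coeff_smul_sigma_zeta_eq (hn : Squarefree n) (X Y : MonoidAlgebra ℚ (ZMod n)ˣ)
    (h : ∑ g : (ZMod n)ˣ, X.coeff g •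
        sigma n g (IsCyclotomicExtension.zeta n ℚ (CyclotomicField n ℚ)) =
      ∑ g : (ZMod n)ˣ, Y.coeff g •
        sigma n g (IsCyclotomicExtension.zeta n ℚ (CyclotomicField n ℚ))) : X = Y := by
  rw [← sub_eq_zero]
  refine eq_zero_of_sum_coeff_smul_sigma_zeta_eq_zero n hn (X - Y) ?_
  simp_rw [MonoidAlgebra.coeff_sub, Finsupp.sub_apply, sub_smul, Finset.sum_sub_distrib, h, sub_self]

set_option backward.isDefEq.respectTransparency false in
/-- **★ The conjugates of `ζ_n` form a normal basis of `ℚ(ζ_n)/ℚ`, `n` square-free**: every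
`x ∈ ℚ(ζ_n)` is `Σ_g X_g · σ_g ζ_n` for a UNIQUE `X ∈ ℚ[(ℤ/n)ˣ]` (injectivity above + the dimension
count `dim_ℚ ℚ(ζ_n) = φ(n) = #(ℤ/n)ˣ`). [folklore] -/
theorem exists_unique_eq_sum_coeff_smul_sigma_zeta (hn : Squarefree n) (x : CyclotomicField n ℚ) :
    ∃! X : MonoidAlgebra ℚ (ZMod n)ˣ, x = ∑ g : (ZMod n)ˣ, X.coeff g •
      sigma n g (IsCyclotomicExtension.zeta n ℚ (CyclotomicField n ℚ)) := by
  -- the evaluation as a ℚ-linear map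
  let ev : MonoidAlgebra ℚ (ZMod n)ˣ →ₗ[ℚ] CyclotomicField n ℚ :=
    { toFun := fun X => ∑ g : (ZMod n)ˣ, X.coeff g •
        sigma n g (IsCyclotomicExtension.zeta n ℚ (CyclotomicField n ℚ))
      map_add' := fun X Y => by
        simp_rw [MonoidAlgebra.coeff_add, Finsupp.add_apply, add_smul, Finset.sum_add_distrib]
      map_smul' := fun q X => by
        simp_rw [MonoidAlgebra.coeff_smul_apply, RingHom.id_apply, Finset.smul_sum, smul_assoc] }
  have hinj : Function.Injective ev := by
    intro X Y hXY
    exact eq_of_sum_coeff_smul_sigma_zeta_eq n hn X Y hXY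
  haveI : Module.Finite ℚ (MonoidAlgebra ℚ (ZMod n)ˣ) :=
    Module.Finite.equiv (MonoidAlgebra.coeffLinearEquiv (R := ℚ)).symm
  have hdim : Module.finrank ℚ (MonoidAlgebra ℚ (ZMod n)ˣ) =
      Module.finrank ℚ (CyclotomicField n ℚ) := by
    rw [(MonoidAlgebra.coeffLinearEquiv (R := ℚ)).finrank_eq, Module.finrank_finsupp_self,
      IsCyclotomicExtension.finrank (CyclotomicField n ℚ) (Polynomial.cyclotomic.irreducible_rat
        (NeZero.pos n)), ZMod.card_units_eq_totient]
  have hsurj : Function.Surjective ev :=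
    (LinearMap.injective_iff_surjective_of_finrank_eq_finrank hdim).mp hinj
  obtain ⟨X, hX⟩ := hsurj x
  exact ⟨X, hX.symm, fun Y hY => hinj (hY.symm.trans hX.symm)⟩

set_option backward.isDefEq.respectTransparency false in
/-- **The character components of the avatar**: if `x = Σ_g X_g · σ_g ζ_n` then
`χ̄(X) = charSum n ι χ x / charSum n ι χ ζ_n` for every `χ` mod the square-free `n` — so PK-4a's
character sums of Kato's `x_{0,r}` ARE the components of its group-ring avatar.
[cite: Kato2004Asterisque, Thm. 6.6 (1) (p. 163)] -/
theorem lift_eq_charSum_div_charSum_zeta (hn : Squarefree n) (ι : CyclotomicField n ℚ →+* ℂ)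
    (χ : DirichletCharacter ℂ n) (X : MonoidAlgebra ℚ (ZMod n)ˣ) {x : CyclotomicField n ℚ}
    (hx : x = ∑ g : (ZMod n)ˣ, X.coeff g •
      sigma n g (IsCyclotomicExtension.zeta n ℚ (CyclotomicField n ℚ))) :
    MonoidAlgebra.lift ℚ ℂ (ZMod n)ˣ ((Units.coeHom ℂ).comp χ⁻¹.toUnitHom) X =
      charSum n ι χ x / charSum n ι χ (IsCyclotomicExtension.zeta n ℚ (CyclotomicField n ℚ)) := by
  rw [eq_div_iff (charSum_zeta_ne_zero_of_squarefree n hn ι χ), hx, charSum_sum_coeff_smul_sigma]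

end GroupRingEval

end Summit.BirchSwinnertonDyer.Rank1Residual.GaloisImage

end
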